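import Summits.HodgeConjecture.HodgeConjecture.Theorems.F0P3KitOfRecord            -- (K0): `kitOfRecord` + read-backs
import Summits.HodgeConjecture.HodgeConjecture.Theorems.F0P3ClassificationLawsV6   -- ★ V6-B p822130 (p03 (g6)): the 23 `Laws` fields of the edition of record
import HarnessLib

/-!
# Crux `H413` — T5 ED. 4, K7 SKELETON: **`(kitOfRecord …).Laws μω hμu` FROM ONE NAMED HYPOTHESIS PER LAW ROW** (PLAN.F0P3g5 §1 + errata), T-rows discharged INLINE

F0P3-plan (g5) 11:41:31Z: «K7: `laws_kitOfRecord_of (letters…) (E-hyps…) : (kitOfRecord …).Laws μω hμu` with one named hypothesis per law row, T-rows discharged inline».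
T-rows inline NOW: #17 `archPacketCoh` ∕ #18 `archMember` (★ p820882 `archPacketCoh_of`∕`archMember_of`, p01 (g8) cert 0478f1b6; modulo the
clauses `JInfNoDegOne`∕`DsInfNoDegOne` on the closer parameters), #9 `unitaryCoord` (★ p821565 `unitaryCoord₀_archDegOne`, UNCONDITIONAL), #11 `classEq` (★ p819048 `cl_eq_cl_iff`), #19 `cptXiSpec` (`id`: `cptXi := cptXi₀` is
the law's conclusion), #16 `tokenInf` HOL half (★ p821565 `tokenInfU_of_isHolCotangentAt`; the ANTIHOL half is the hypothesis `hTokA` until p02's (B-ii)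
`F0P3AntiholCohUnitaryToken` lands).  Every other row is a NAMED HYPOTHESIS in the law's literal shape at `𝔠₀` (E-rows: T1∕(J2)∕P3b exports; L-rows: the letters of
PLAN §1; the ξ-side T-rows #20–#23 are hypotheses on the bundled parameter `ξd`, discharged by p01's ★ closed forms at K9).  No `sorry`, no named fact;
`--supports stmt-HodgeConjecture-24833 --as helper`.  HONEST LABEL: HC_CM is proved only modulo the printed citations until rung 0 closes.
-/

set_option autoImplicit false
set_option linter.dupNamespace false

-- Mathlib idiom (★ (𝔤,K) files): commutator bracket on `Module.End ℂ M`, to MENTION the token binders of law `TokenInf`.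
attribute [local instance 100] LieRing.ofAssociativeRing

noncomputable section

open NumberField IsDedekindDomain MeasureTheory
open Literature.NumberTheory.Rogawski1990 Literature.NumberTheory.GaloisRepresentations
open Literature.NumberTheory.Automorphic Literature.NumberTheory.Automorphic.UnitaryGroup
open Literature.NumberTheory.Automorphic.UnitaryGroup.CotangentForms
open Literature.RepresentationTheory.BorelWallach2000 Literature.RepresentationTheory.KonnoKonno2007
open scoped Matrix ComplexOrder

namespace Summit.HodgeConjecture.HodgeConjecture.Cruxes.H413.F0P3KitOfRecord

open Summit.HodgeConjecture.HodgeConjecture.Cruxes.H413.F0P3InnerFormClassificationV6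
open Summit.HodgeConjecture.HodgeConjecture.Cruxes.H413.F0P3ClassTokensOfRecord (Cls cl rep mult cl_eq_cl_iff)
open Summit.HodgeConjecture.HodgeConjecture.Cruxes.H413.F0P3UnitaryLocOfRecord (clInfChoiceU unitaryLoc₀ unitaryCoord₀_archDegOne tokenInfU_of_isHolCotangentAt)
open Summit.HodgeConjecture.HodgeConjecture.Cruxes.H413.F0P3SemilocalTestFunctionsOfRecord (TestS₀)
open Summit.HodgeConjecture.HodgeConjecture.Cruxes.H413.F0P3bArchDegOneClass (archDegOneClass)
open Summit.HodgeConjecture.HodgeConjecture.Cruxes.H413.F0P3XiArchPacketOfRecord (JInfNoDegOne DsInfNoDegOne archPacketCoh_of archMember_of)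

variable (L : Type) [Field L] [NumberField L] [IsCMField L] (H : Matrix (Fin 3) (Fin 3) L) (ι : L →+* ℂ) (T : GL (Fin 3) ℂ)
  (hT : (T : Matrix (Fin 3) (Fin 3) ℂ)ᴴ * H.map ι * (T : Matrix (Fin 3) (Fin 3) ℂ) = Literature.Geometry.ComplexHyperbolic.BallModel.J)
  (μ : Measure (Gp L H).automorphicQuotient) [(Gp L H).IsAutomorphicMeasure μ]
  [MeasurableSpace (Gp L H).Adelic] [BorelSpace (Gp L H).Adelic]
  (𝔰 : Sockets L H μ) (gh : GHSide L H ι T hT 𝔰.PacketG 𝔰.PacketH) (ξd : XiSide L H 𝔰.PacketG 𝔰.PacketH)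
  (μω : HeckeCharacter L) (hμu : μω.IsUnitary) (c : ℚ) (jInf dsInf : ℤ → ℤ → ℤ → Cinf)
  (archTr : Cinf → (UnitaryGroup.arch (↥(maximalRealSubfield L)) L (IsCMField.complexConj L) 3 H → ℂ) → ℂ)
  (ν : Measure (Gp L H).Adelic) [IsFiniteMeasureOnCompacts ν]
  (μv : ∀ v : Places L, @Measure ((cmDatum L 3 H).Local v) (borel _))
  (ramCls₀ : DiscreteAutomorphicRep (Gp L H) μ → Set (Places L))

/-! ## §1 The T-rows at `𝔠₀`, inline -/

/-- **Row #9 `UnitaryCoord` at 𝔠₀ — UNCONDITIONAL** (★ `unitaryCoord₀_archDegOne`: the arch token `clInfChoiceU [J⁺]` is coh-unitary by construction, every finite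
coordinate `clFinChoice` is unitarizable in all three branches). [cite: Rogawski1990, Prop. 13.8.1 p. 206; §14.5 p. 237] -/
theorem unitaryCoord_kitOfRecord : (kitOfRecord L H ι T hT μ 𝔰 gh ξd μω c jInf dsInf archTr ν μv ramCls₀).UnitaryCoord :=
  fun S x => unitaryCoord₀_archDegOne L H ι T hT μ S x

/-- **Row #11 `ClassEq` at 𝔠₀** (★ `cl_eq_cl_iff`). [cite: Dixmier1977, 5.4.6] -/
theorem classEq_kitOfRecord : (kitOfRecord L H ι T hT μ 𝔰 gh ξd μω c jInf dsInf archTr ν μv ramCls₀).ClassEq :=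
  fun P P' => cl_eq_cl_iff (Gp L H) μ P P'

/-- **Row #19 `CptXiSpec μω` at 𝔠₀ — DEFINITIONAL** (`cptXi := cptXi₀ ι μω` is the law's conclusion). [cite: Rogawski1990, §12.3 p. 176] -/
theorem cptXiSpec_kitOfRecord : (kitOfRecord L H ι T hT μ 𝔰 gh ξd μω c jInf dsInf archTr ν μv ramCls₀).CptXiSpec μω :=
  fun _ h => h

/-- **Row #17 `ArchPacketCoh` at 𝔠₀** (p01 (g8), ★ p820882 `archPacketCoh_of`: on the cohomological locus `πn = archDegOneClass (sgnInf₀ ξ)` and X1′ rigidity, off it the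
residual clauses `JInfNoDegOne`∕`DsInfNoDegOne` on the closer parameters, R-22′). [cite: Rogawski1990, §12.3 p. 178, Prop. 12.3.3; Prop. 15.2.1 (a)(b)] [cite: BorelWallach2000, VI Thm. 4.11] -/
theorem archPacketCoh_kitOfRecord (hJ : JInfNoDegOne jInf) (hD : DsInfNoDegOne dsInf) :
    (kitOfRecord L H ι T hT μ 𝔰 gh ξd μω c jInf dsInf archTr ν μv ramCls₀).ArchPacketCoh :=
  archPacketCoh_of jInf dsInf ι μω hJ hD

include hμu in
/-- **Row #18 `ArchMember μω` at 𝔠₀** (p01 (g8), ★ p820882 `archMember_of`; `μω` unitary with `μω|_{𝕀_{L⁺}} = ω`). [cite: Rogawski1990, §12.3 pp. 176–178, Prop. 12.3.3; Prop. 15.2.1 (a)] -/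
theorem archMember_kitOfRecord
    (hμω : ∀ x : Literature.NumberTheory.GaloisRepresentations.ideleGroup ↥(maximalRealSubfield L),
      μω (AdeleRing.ideleBaseChange (↥(maximalRealSubfield L)) L x) = quadraticHeckeCharCM L x)
    (hJ : JInfNoDegOne jInf) (hD : DsInfNoDegOne dsInf) :
    (kitOfRecord L H ι T hT μ 𝔰 gh ξd μω c jInf dsInf archTr ν μv ramCls₀).ArchMember μω :=
  archMember_of jInf dsInf ι μω hμu hμω hJ hD

/-- **Row #16 `TokenInf` at 𝔠₀ under the head's guard `IsCot`**: HOLOMORPHIC half ★ `tokenInfU_of_isHolCotangentAt` (F1a in-house + a coh-unitary token); the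
ANTIHOLOMORPHIC half is the hypothesis `hTokA` (p02 (g7) (B-ii) `F0P3AntiholCohUnitaryToken`, conj transport — pending). [cite: Rogawski1990, Prop. 15.2.1 (b); §15.3]
[cite: BorelWallach2000, VI Thm. 4.11] -/
theorem tokenInf_kitOfRecord_of
    (hdef : ∀ τ' : L →+* ℂ, InfinitePlace.mk τ' ≠ InfinitePlace.mk ι → (H.map τ').PosDef) (h2 : 2 ≤ Module.finrank ℚ ↥(maximalRealSubfield L))
    (hTokA : ∀ (P : DiscreteAutomorphicRep (Gp L H) μ), P.IsAntiholCotangentAt (cmArchSection L ι H T hT) (cmCompactFactor L ι H T hT) →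
      ∀ (M : Type) [AddCommGroup M] [Module ℂ M] (σK : Representation ℂ (uFormGroup (Fin 2) (Fin 1)).maximalCompact M)
        (σ𝔤 : (uFormGroup (Fin 2) (Fin 1)).lie →ₗ⁅ℝ⁆ Module.End ℂ M) (hM : IsGKModule (uFormGroup (Fin 2) (Fin 1)) σK σ𝔤) (hirr : IsIrreducibleGK σK σ𝔤),
        HasToken L H ι T hT μ P M σK σ𝔤 →
        clInfChoiceU L H ι T hT μ (archDegOneClass 1 (Or.inl rfl)) (rep (Gp L H) μ (cl (Gp L H) μ P)) = GKIrrClass.ofModule M σK σ𝔤 hM hirr) :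
    (kitOfRecord L H ι T hT μ 𝔰 gh ξd μω c jInf dsInf archTr ν μv ramCls₀).TokenInf := by
  intro P hP M _ _ σK σ𝔤 hM hirr htok
  rcases hP with hP | hP
  · exact tokenInfU_of_isHolCotangentAt L H ι T hT μ hdef h2 (archDegOneClass 1 (Or.inl rfl)) P hP hM hirr htok
  · exact hTokA P hP M σK σ𝔤 hM hirr htok

/-! ## §2 K7 skeleton: the `Laws` of `𝔠₀` from one named hypothesis per row -/

/-- **K7 SKELETON — `(kitOfRecord …).Laws μω hμu`** from ONE named hypothesis per law row of PLAN.F0P3g5 §1 (E-rows = exports of T1∕(J2)∕P3b; L-rows = letters;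
ξ-side rows = hypotheses on `ξd`), the T-rows #9 #11 #17 #18 #19 and the hol half of #16 discharged inline (§1). [cite: Rogawski1990, §14.6 Thm. 14.6.4 pp. 236–244] -/
theorem laws_kitOfRecord_of
    (hdef : ∀ τ' : L →+* ℂ, InfinitePlace.mk τ' ≠ InfinitePlace.mk ι → (H.map τ').PosDef) (h2 : 2 ≤ Module.finrank ℚ ↥(maximalRealSubfield L))
    -- E-rows (T1 ∕ (J2) ∕ P3a–P3b exports)
    (h1 : (kitOfRecord L H ι T hT μ 𝔰 gh ξd μω c jInf dsInf archTr ν μv ramCls₀).TraceIdentity)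
    (h2' : (kitOfRecord L H ι T hT μ 𝔰 gh ξd μω c jInf dsInf archTr ν μv ramCls₀).SpectralSideGp)
    (h3 : (kitOfRecord L H ι T hT μ 𝔰 gh ξd μω c jInf dsInf archTr ν μv ramCls₀).Factorisation)
    (h4 : (kitOfRecord L H ι T hT μ 𝔰 gh ξd μω c jInf dsInf archTr ν μv ramCls₀).MatchingS)
    (h5 : (kitOfRecord L H ι T hT μ 𝔰 gh ξd μω c jInf dsInf archTr ν μv ramCls₀).TransferS)
    (h6 : (kitOfRecord L H ι T hT μ 𝔰 gh ξd μω c jInf dsInf archTr ν μv ramCls₀).HatBounded)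
    (h7 : (kitOfRecord L H ι T hT μ 𝔰 gh ξd μω c jInf dsInf archTr ν μv ramCls₀).UnrStarAlgebra)
    -- L-rows (letters of PLAN §1 + errata) and P3b∕(J2)-indexed rows
    (h8 : (kitOfRecord L H ι T hT μ 𝔰 gh ξd μω c jInf dsInf archTr ν μv ramCls₀).LinIndepS)
    (h10 : (kitOfRecord L H ι T hT μ 𝔰 gh ξd μω c jInf dsInf archTr ν μv ramCls₀).UnitaryPacket)
    (h12 : (kitOfRecord L H ι T hT μ 𝔰 gh ξd μω c jInf dsInf archTr ν μv ramCls₀).FlathDet)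
    (h13 : (kitOfRecord L H ι T hT μ 𝔰 gh ξd μω c jInf dsInf archTr ν μv ramCls₀).APacketSpectral)
    (h14 : (kitOfRecord L H ι T hT μ 𝔰 gh ξd μω c jInf dsInf archTr ν μv ramCls₀).LocalExpansion)
    (h15 : (kitOfRecord L H ι T hT μ 𝔰 gh ξd μω c jInf dsInf archTr ν μv ramCls₀).Routing)
    (hTokA : ∀ (P : DiscreteAutomorphicRep (Gp L H) μ), P.IsAntiholCotangentAt (cmArchSection L ι H T hT) (cmCompactFactor L ι H T hT) →
      ∀ (M : Type) [AddCommGroup M] [Module ℂ M] (σK : Representation ℂ (uFormGroup (Fin 2) (Fin 1)).maximalCompact M)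
        (σ𝔤 : (uFormGroup (Fin 2) (Fin 1)).lie →ₗ⁅ℝ⁆ Module.End ℂ M) (hM : IsGKModule (uFormGroup (Fin 2) (Fin 1)) σK σ𝔤) (hirr : IsIrreducibleGK σK σ𝔤),
        HasToken L H ι T hT μ P M σK σ𝔤 →
        clInfChoiceU L H ι T hT μ (archDegOneClass 1 (Or.inl rfl)) (rep (Gp L H) μ (cl (Gp L H) μ P)) = GKIrrClass.ofModule M σK σ𝔤 hM hirr)
    -- rows #17 #18: the residual arch clauses on the closer parameters (R-22′) and the `μω` normalisation (§4.8 p. 51)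
    (hμω : ∀ x : Literature.NumberTheory.GaloisRepresentations.ideleGroup ↥(maximalRealSubfield L),
      μω (AdeleRing.ideleBaseChange (↥(maximalRealSubfield L)) L x) = quadraticHeckeCharCM L x)
    (hJ : JInfNoDegOne jInf) (hD : DsInfNoDegOne dsInf)
    -- ξ-side rows (hypotheses on `ξd`; ★ closed forms p819611∕p820295 at K9)
    (h20 : (kitOfRecord L H ι T hT μ 𝔰 gh ξd μω c jInf dsInf archTr ν μv ramCls₀).XiFamilyFin μω hμu)
    (h21 : (kitOfRecord L H ι T hT μ 𝔰 gh ξd μω c jInf dsInf archTr ν μv ramCls₀).XiUnram)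
    (h22 : (kitOfRecord L H ι T hT μ 𝔰 gh ξd μω c jInf dsInf archTr ν μv ramCls₀).LocalIsotypyFin)
    (h23 : (kitOfRecord L H ι T hT μ 𝔰 gh ξd μω c jInf dsInf archTr ν μv ramCls₀).EvpConvention) :
    (kitOfRecord L H ι T hT μ 𝔰 gh ξd μω c jInf dsInf archTr ν μv ramCls₀).Laws μω hμu where
  traceIdentity := h1
  spectralSideGp := h2'
  factorisation := h3
  matchingS := h4
  transferS := h5
  hatBounded := h6
  unrStarAlgebra := h7
  linIndepS := h8
  unitaryCoord := unitaryCoord_kitOfRecord L H ι T hT μ 𝔰 gh ξd μω c jInf dsInf archTr ν μv ramCls₀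
  unitaryPacket := h10
  classEq := classEq_kitOfRecord L H ι T hT μ 𝔰 gh ξd μω c jInf dsInf archTr ν μv ramCls₀
  flathDet := h12
  aPacketSpectral := h13
  localExpansion := h14
  routing := h15
  tokenInf := tokenInf_kitOfRecord_of L H ι T hT μ 𝔰 gh ξd μω c jInf dsInf archTr ν μv ramCls₀ hdef h2 hTokA
  archPacketCoh := archPacketCoh_kitOfRecord L H ι T hT μ 𝔰 gh ξd μω c jInf dsInf archTr ν μv ramCls₀ hJ hD
  archMember := archMember_kitOfRecord L H ι T hT μ 𝔰 gh ξd μω hμu c jInf dsInf archTr ν μv ramCls₀ hμω hJ hD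
  cptXiSpec := cptXiSpec_kitOfRecord L H ι T hT μ 𝔰 gh ξd μω c jInf dsInf archTr ν μv ramCls₀
  xiFamilyFin := h20
  xiUnram := h21
  localIsotypyFin := h22
  evpConvention := h23

end Summit.HodgeConjecture.HodgeConjecture.Cruxes.H413.F0P3KitOfRecord

end
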